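import Mathlib
import Summits.QuantumFields.YangMills.Theorems.FlatTubeReductionGroundStateConcentration
import Summits.QuantumFields.YangMills.Theorems.FlatTubeReductionValleyRelocalisationPinning
import Summits.QuantumFields.YangMills.Theorems.TransportFieldFanoTorelonFloor
import HarnessLib

/-!
# Vacuum torelon CEILING at every fixed lattice size `L ≥ 2`: `E_{Ω²}[F] ≤ (18L² + 4)·β^{−2/39}` for `β ≥ β₀(L)`
# (route `TransportFieldFano`, LINE g17-A, crux ⟨stmt-QuantumFields-23353⟩ `MeanLoopCeilingWeak` helper lane — the ceiling twin of
# ✓`…TransportFieldFanoTorelonFloor`; the registered BC5 rung `stub_rung_fixedTorus` of ⟨23353⟩ asks the same bound with exponent `1/2`)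

The registered fixed-torus rung of `MeanLoopCeilingWeak` reads: at ONE lattice size `L₀ ≥ 2`, for `β ≥ β₀`, every `l2`-normalised physical
exact vacuum `Ω` (`K_βΩ = λ₀Ω`) has `E_{Ω²}[F] ≤ C·β^{−1/2}`, `F = flowLift 0 (4 − (Re tr P)²)` the site-averaged adjoint torelon deviation
(zero-mode LOCALISATION of the interacting vacuum at the flat, centre-valued Polyakov holonomies).  This file proves the QUALITATIVE form of
that statement at EVERY `L ≥ 2`, with the exponent the tree's landed concentration theorem affords:

* §1 `torelonDev_le_four_mul_two_sub_abs` — `4 − (Re tr ρ(P))² ≤ 4·(2 − |Re tr ρ(P)|)` and `≤ 4` (pointwise on `SU(2)`);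
* §2 ★ `flowLiftAt_torelonDev_le_of_orbitDist_lt` / `flowLift_torelonDev_le_of_orbitDist_lt` — POLYAKOV PINNING: if some twisted copy
  `twist3 z U` is within orbit distance `r` of the pure gauges then every torelon deviation of `U` is `≤ 2(L·r)²`
  (✓`ValleyReloc.two_sub_abs_re_trace_polyakovSite_le`);
* §3 ★★ `l2_torelon_mul_vacuum_le_inner_outer` — for every `δ > 0` and every physical `Ω`, the INNER/OUTER split along RED's twist-symmetrised
  inner phase `Θ_δ` (✓`innerPhase`, `cos² + sin² = 1`): `E_{Ω²}[F] ≤ 2(Lδ)²·‖Ω‖² + 4·‖sin Θ_δ·Ω‖²` (the `cos`-piece lives where some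
  twisted orbit distance is `< δ`, ✓`exists_orbitDist_lt_of_cos_ne_zero`; `F ≤ 4` on the `sin`-piece);
* §4 ★★★ `vacuum_torelon_mean_le` — for `L ≥ 2` there is `β₀(L)` with `E_{Ω²}[F] ≤ (18L² + 4)·β^{−2/39}` for `β ≥ β₀`, every physical
  `l2`-normalised exact vacuum (`δ = 3β^{−1/39}` and FTR's ✓`GroundConc.groundState_outer_mass_le`: the vacuum mass outside the
  `3β^{−1/39}`-windows of the eight central orbits is `≤ ‖Ω‖²/β`); the same bound sitewise (`vacuum_torelonAt_mean_le`);
* §5 ★★ `fixedTorusRung_two_39` — the registered rung's letters with `β^{−2/39}` in place of `β^{−1/2}`, at EVERY `L₀ ≥ 2`.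
So `e^{−15}/β² ≤ E_{Ω²}[F] ≤ (18L² + 4)β^{−2/39}` (floor: ✓`torelonDev_vacuum_mean_ge`): the Polyakov holonomy of the exact zero-flux vacuum
concentrates at the centre `{±1}` as `β → ∞` on every fixed spatial torus — qualitative zero-mode localisation.  The exponent `2/39` is RED's
valley scale `β^{−1/39}` (✓`valleyGainAt_pow_of_two_le`), far from the Lüscher scale `β^{−1/3}`; reaching the rung's `1/2` at `L ≥ 2` needs an
eigen-scale outer coercivity on the torus (the fibred Born–Oppenheimer transport of the one-site ✓`RateTube.absRate_eigenScale`), not claimed.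
HONEST FRAMING: fixed-lattice helper corollary of landed FTR/RED theorems (`--supports 23353`); no registered stub is closed by name; nothing
about infinite volume, the continuum or the Yang–Mills mass gap; no summit statement.  No `sorry`, no new definition, no named-fact hypothesis.
References: [cite: Luscher1983, §2–3]; [cite: SimonB1983DiscreteSpectrum, §3]; [cite: tHooft1979].
-/

set_option autoImplicit false

noncomputable section

open MeasureTheory Filter Topology Real
open Literature.MathematicalPhysics.QuantumFieldTheory (GaugeConfig Site Edge lineHolonomy wilsonFlow_zero)
open Literature.MathematicalPhysics.QuantumLattice (fundamentalRep_apply secondCountableTopology_su2)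

namespace Summit.QuantumFields.YangMills.Theorems.TransportFieldFano

open Summit.QuantumFields.YangMills.Theorems.FemtoTransferGap

variable {L : ℕ} [NeZero L]

/-! ## §1 The torelon deviation on `SU(2)`: `0 ≤ 4 − (Re tr ρ(P))² ≤ 4(2 − |Re tr ρ(P)|) ≤ 4` -/

/-- `4 − (Re tr ρ(P))² ≤ 4·(2 − |Re tr ρ(P)|)` (`|Re tr ρ(P)| ≤ 2`, so `2 + |Re tr| ≤ 4`). [folklore] -/
theorem torelonDev_le_four_mul_two_sub_abs (P : SU2) :
    4 - ((su2Rep P).trace.re) ^ 2 ≤ 4 * (2 - |(su2Rep P).trace.re|) := by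
  rw [fundamentalRep_apply]
  set a : ℝ := ((P : Matrix (Fin 2) (Fin 2) ℂ).trace).re with ha
  have h1 : a ≤ 2 := re_trace_le_two P
  have h2 : -2 ≤ a := neg_two_le_re_trace P
  have hab : |a| ≤ 2 := abs_le.mpr ⟨by linarith, h1⟩
  have hsq : |a| ^ 2 = a ^ 2 := sq_abs a
  nlinarith [abs_nonneg a]

/-- `4 − (Re tr ρ(P))² ≤ 4`. [folklore] -/
theorem torelonDev_le_four (P : SU2) : 4 - ((su2Rep P).trace.re) ^ 2 ≤ 4 := by
  nlinarith [sq_nonneg ((su2Rep P).trace.re)]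

/-- `0 ≤ 4 − (Re tr ρ(P))²`. [folklore] -/
theorem torelonDev_nonneg (P : SU2) : 0 ≤ 4 - ((su2Rep P).trace.re) ^ 2 := by
  rw [fundamentalRep_apply]
  nlinarith [re_trace_le_two P, neg_two_le_re_trace P]

/-! ## §2 Polyakov pinning near a twisted pure-gauge orbit -/

/-- ★ **Pinning of the torelon deviation at a base point**: if `orbitDist (twist3 z U) < r` for some composite twist `z`, then
`d_x(U) = 4 − (Re tr ρ(P₀(x)(U)))² ≤ 2(L·r)²` for every site `x`. [cite: tHooft1979] [cite: Luscher1983, §2] -/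
theorem flowLiftAt_torelonDev_le_of_orbitDist_lt {U : GaugeConfig 3 L SU2} {r : ℝ} (z : Fin 3 → Bool)
    (hU : orbitDist (TT.twist3 z U) < r) (x : Site 3 L) :
    flowLiftAt x 0 (fun u : GaugeConfig 3 1 SU2 => 4 - ((su2Rep (u ((0 : Site 3 1), (0 : Fin 3)))).trace.re) ^ 2) U ≤
      2 * ((L : ℝ) * r) ^ 2 := by
  have hpin := ValleyReloc.two_sub_abs_re_trace_polyakovSite_le z hU x ((0 : Site 3 1), (0 : Fin 3))
  have hdev := torelonDev_le_four_mul_two_sub_abs (polyakovSite x U ((0 : Site 3 1), (0 : Fin 3)))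
  have e : flowLiftAt x 0 (fun u : GaugeConfig 3 1 SU2 => 4 - ((su2Rep (u ((0 : Site 3 1), (0 : Fin 3)))).trace.re) ^ 2) U =
      4 - ((su2Rep (polyakovSite x U ((0 : Site 3 1), (0 : Fin 3)))).trace.re) ^ 2 := by
    simp only [flowLiftAt, wilsonFlow_zero]
  rw [e]
  linarith

/-- ★ **Pinning of the site-averaged torelon deviation**: under the same hypothesis `F(U) ≤ 2(L·r)²`. [cite: tHooft1979] [cite: Luscher1983, §2] -/
theorem flowLift_torelonDev_le_of_orbitDist_lt {U : GaugeConfig 3 L SU2} {r : ℝ} (z : Fin 3 → Bool)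
    (hU : orbitDist (TT.twist3 z U) < r) :
    flowLift 0 (fun u : GaugeConfig 3 1 SU2 => 4 - ((su2Rep (u ((0 : Site 3 1), (0 : Fin 3)))).trace.re) ^ 2) U ≤
      2 * ((L : ℝ) * r) ^ 2 := by
  unfold flowLift
  have hcard : (0 : ℝ) < (Fintype.card (Site 3 L) : ℝ) := by exact_mod_cast Fintype.card_pos
  rw [div_le_iff₀ hcard]
  calc ∑ x : Site 3 L, flowLiftAt x 0 (fun u : GaugeConfig 3 1 SU2 => 4 - ((su2Rep (u ((0 : Site 3 1), (0 : Fin 3)))).trace.re) ^ 2) U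
      ≤ ∑ _x : Site 3 L, 2 * ((L : ℝ) * r) ^ 2 :=
        Finset.sum_le_sum fun x _ => flowLiftAt_torelonDev_le_of_orbitDist_lt z hU x
    _ = 2 * ((L : ℝ) * r) ^ 2 * (Fintype.card (Site 3 L) : ℝ) := by
        rw [Finset.sum_const, Finset.card_univ, nsmul_eq_mul]; ring

/-- The site-averaged torelon deviation is at most `4`. [folklore] -/
theorem flowLift_torelonDev_le_four (U : GaugeConfig 3 L SU2) :
    flowLift 0 (fun u : GaugeConfig 3 1 SU2 => 4 - ((su2Rep (u ((0 : Site 3 1), (0 : Fin 3)))).trace.re) ^ 2) U ≤ 4 := by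
  unfold flowLift
  have hcard : (0 : ℝ) < (Fintype.card (Site 3 L) : ℝ) := by exact_mod_cast Fintype.card_pos
  rw [div_le_iff₀ hcard]
  calc ∑ x : Site 3 L, flowLiftAt x 0 (fun u : GaugeConfig 3 1 SU2 => 4 - ((su2Rep (u ((0 : Site 3 1), (0 : Fin 3)))).trace.re) ^ 2) U
      ≤ ∑ _x : Site 3 L, (4 : ℝ) := Finset.sum_le_sum fun x _ => by
        simp only [flowLiftAt, wilsonFlow_zero]; exact torelonDev_le_four _
    _ = 4 * (Fintype.card (Site 3 L) : ℝ) := by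
        rw [Finset.sum_const, Finset.card_univ, nsmul_eq_mul]; ring

/-- The torelon deviation at a base point is at most `4`. [folklore] -/
theorem flowLiftAt_torelonDev_le_four (x : Site 3 L) (U : GaugeConfig 3 L SU2) :
    flowLiftAt x 0 (fun u : GaugeConfig 3 1 SU2 => 4 - ((su2Rep (u ((0 : Site 3 1), (0 : Fin 3)))).trace.re) ^ 2) U ≤ 4 := by
  simp only [flowLiftAt, wilsonFlow_zero]; exact torelonDev_le_four _

/-! ## §3 The inner/outer split of a bounded, pinned observable -/

/-- ★★ **INNER/OUTER SPLIT** (deterministic; every `δ > 0`, every physical `Ω`).  Let `g` be a measurable observable with `g ≤ 4` everywhere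
and `g(U) ≤ 2(Lδ)²` whenever some twisted copy of `U` is within orbit distance `δ` of the pure gauges.  Then
`∫ g·Ω² ≤ 2(Lδ)²·‖Ω‖² + 4·‖sin Θ_δ·Ω‖²`, `Θ_δ` RED's inner phase: on `{cos Θ_δ ≠ 0}` some twisted orbit distance is `< δ`
(✓`exists_orbitDist_lt_of_cos_ne_zero`), elsewhere `sin² Θ_δ = 1`. [cite: SimonB1983DiscreteSpectrum, §3] [cite: Luscher1983, §2] -/
theorem l2_mul_vacuum_le_inner_outer_of_pinned {δ : ℝ} (hδ : 0 < δ) {g : GaugeConfig 3 L SU2 → ℝ} (hgm : Measurable g)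
    (hg0 : ∀ U, 0 ≤ g U) (hg4 : ∀ U, g U ≤ 4)
    (hgpin : ∀ U (z : Fin 3 → Bool), orbitDist (TT.twist3 z U) < δ → g U ≤ 2 * ((L : ℝ) * δ) ^ 2)
    {Ω : GaugeConfig 3 L SU2 → ℝ} (hΩ : IsPhys Ω) :
    l2 (fun U => g U * Ω U) Ω ≤
      2 * ((L : ℝ) * δ) ^ 2 * l2 Ω Ω +
        4 * l2 (fun U => Real.sin (innerPhase δ U) * Ω U) (fun U => Real.sin (innerPhase δ U) * Ω U) := by
  haveI : SecondCountableTopology SU2 := secondCountableTopology_su2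
  -- pointwise comparison
  have hpt : ∀ U, g U * Ω U * Ω U ≤
      2 * ((L : ℝ) * δ) ^ 2 * (Ω U * Ω U) + 4 * (Real.sin (innerPhase δ U) * Ω U * (Real.sin (innerPhase δ U) * Ω U)) := by
    intro U
    have hΩ2 : 0 ≤ Ω U * Ω U := mul_self_nonneg _
    have hs2 : 0 ≤ Real.sin (innerPhase δ U) * Ω U * (Real.sin (innerPhase δ U) * Ω U) := mul_self_nonneg _
    by_cases hcos : Real.cos (innerPhase δ U) = 0
    · -- outer point: `sin² Θ = 1`, use `g ≤ 4`
      have hsin : Real.sin (innerPhase δ U) ^ 2 = 1 := by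
        have := Real.sin_sq_add_cos_sq (innerPhase δ U); rw [hcos] at this; linarith
      have e4 : Real.sin (innerPhase δ U) * Ω U * (Real.sin (innerPhase δ U) * Ω U) = Ω U * Ω U := by
        have : Real.sin (innerPhase δ U) * Ω U * (Real.sin (innerPhase δ U) * Ω U) =
            Real.sin (innerPhase δ U) ^ 2 * (Ω U * Ω U) := by ring
        rw [this, hsin, one_mul]
      rw [e4]
      have hδ2 : 0 ≤ 2 * ((L : ℝ) * δ) ^ 2 * (Ω U * Ω U) := by positivity
      nlinarith [hg4 U]
    · -- inner point: some twisted orbit distance is `< δ`, use the pinning hypothesis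
      obtain ⟨z, hz⟩ := exists_orbitDist_lt_of_cos_ne_zero hδ hcos
      have hgU := hgpin U z hz
      nlinarith
  -- integrability of both sides
  have hΩΩ : Integrable (fun U => Ω U * Ω U) (configMeasure SU2 L) :=
    hΩ.integrable_sq.congr (ae_of_all _ fun U => by simp only [sq])
  have hgb : ∀ U, ‖g U‖ ≤ 4 := fun U => by
    rw [Real.norm_eq_abs, abs_of_nonneg (hg0 U)]; exact hg4 U
  have hgΩΩ : Integrable (fun U => g U * Ω U * Ω U) (configMeasure SU2 L) := by
    have h : Integrable (fun U => g U * (Ω U * Ω U)) (configMeasure SU2 L) :=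
      hΩΩ.bdd_mul hgm.aestronglyMeasurable (ae_of_all _ hgb)
    exact h.congr (ae_of_all _ fun U => by ring)
  have hsm : Measurable fun U : GaugeConfig 3 L SU2 => Real.sin (innerPhase δ U) :=
    Real.measurable_sin.comp (measurable_innerPhase δ)
  have hsb : ∀ U : GaugeConfig 3 L SU2, ‖Real.sin (innerPhase δ U) ^ 2‖ ≤ 1 := fun U => by
    rw [Real.norm_eq_abs, abs_of_nonneg (sq_nonneg _)]
    exact Real.sin_sq_le_one _
  have hsΩΩ : Integrable (fun U => Real.sin (innerPhase δ U) * Ω U * (Real.sin (innerPhase δ U) * Ω U))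
      (configMeasure SU2 L) := by
    have h : Integrable (fun U => Real.sin (innerPhase δ U) ^ 2 * (Ω U * Ω U)) (configMeasure SU2 L) :=
      hΩΩ.bdd_mul (hsm.pow_const 2).aestronglyMeasurable (ae_of_all _ hsb)
    exact h.congr (ae_of_all _ fun U => by ring)
  have hrhs : Integrable (fun U => 2 * ((L : ℝ) * δ) ^ 2 * (Ω U * Ω U) +
      4 * (Real.sin (innerPhase δ U) * Ω U * (Real.sin (innerPhase δ U) * Ω U))) (configMeasure SU2 L) :=
    (hΩΩ.const_mul _).add (hsΩΩ.const_mul _)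
  -- integrate
  have hint := integral_mono hgΩΩ hrhs hpt
  rw [integral_add (hΩΩ.const_mul _) (hsΩΩ.const_mul _), integral_const_mul, integral_const_mul] at hint
  unfold l2
  exact hint

/-- ★★ **INNER/OUTER SPLIT for the site-averaged torelon deviation** `F = flowLift 0 (4 − (Re tr P)²)`: for every `δ > 0` and every physical `Ω`,
`E[F·Ω²] ≤ 2(Lδ)²·‖Ω‖² + 4·‖sin Θ_δ·Ω‖²`. [cite: SimonB1983DiscreteSpectrum, §3] [cite: Luscher1983, §2] -/
theorem l2_torelon_mul_vacuum_le_inner_outer {δ : ℝ} (hδ : 0 < δ) {Ω : GaugeConfig 3 L SU2 → ℝ} (hΩ : IsPhys Ω) :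
    l2 (fun U => flowLift 0 (fun u : GaugeConfig 3 1 SU2 => 4 - ((su2Rep (u ((0 : Site 3 1), (0 : Fin 3)))).trace.re) ^ 2) U * Ω U) Ω ≤
      2 * ((L : ℝ) * δ) ^ 2 * l2 Ω Ω +
        4 * l2 (fun U => Real.sin (innerPhase δ U) * Ω U) (fun U => Real.sin (innerPhase δ U) * Ω U) := by
  refine l2_mul_vacuum_le_inner_outer_of_pinned hδ (AdjointLoopFano.isPhys_adjLoop (L := L)).measurable (fun U => ?_)
    flowLift_torelonDev_le_four (fun U z hz => flowLift_torelonDev_le_of_orbitDist_lt z hz) hΩ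
  -- `0 ≤ F`
  unfold flowLift
  refine div_nonneg (Finset.sum_nonneg fun x _ => ?_) (by positivity)
  simp only [flowLiftAt, wilsonFlow_zero]; exact torelonDev_nonneg _

/-- ★★ The same split for the torelon deviation at ONE base point `x`. [cite: SimonB1983DiscreteSpectrum, §3] [cite: Luscher1983, §2] -/
theorem l2_torelonAt_mul_vacuum_le_inner_outer {δ : ℝ} (hδ : 0 < δ) (x : Site 3 L) {Ω : GaugeConfig 3 L SU2 → ℝ} (hΩ : IsPhys Ω) :
    l2 (fun U => flowLiftAt x 0 (fun u : GaugeConfig 3 1 SU2 => 4 - ((su2Rep (u ((0 : Site 3 1), (0 : Fin 3)))).trace.re) ^ 2) U * Ω U) Ω ≤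
      2 * ((L : ℝ) * δ) ^ 2 * l2 Ω Ω +
        4 * l2 (fun U => Real.sin (innerPhase δ U) * Ω U) (fun U => Real.sin (innerPhase δ U) * Ω U) := by
  refine l2_mul_vacuum_le_inner_outer_of_pinned hδ (AdjointLoopFano.isPhys_adjLoopAt (L := L) x).measurable (fun U => ?_)
    (flowLiftAt_torelonDev_le_four x) (fun U z hz => flowLiftAt_torelonDev_le_of_orbitDist_lt z hz x) hΩ
  simp only [flowLiftAt, wilsonFlow_zero]; exact torelonDev_nonneg _

/-! ## §4 The vacuum torelon ceiling at every `L ≥ 2` -/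

/-- Real arithmetic of the endgame: for `β ≥ 1`, `18L²·(β^{−1/39})² + 4/β ≤ (18L² + 4)·β^{−2/39}`. [folklore] -/
theorem ceiling_arith {β : ℝ} (hβ : 1 ≤ β) (L' : ℝ) :
    2 * (L' * (3 * β ^ (-(1 / 39 : ℝ)))) ^ 2 * 1 + 4 * (1 / β) ≤ (18 * L' ^ 2 + 4) * β ^ (-(2 : ℝ) / 39) := by
  have hβ0 : 0 < β := by linarith
  have hsq : (β ^ (-(1 / 39 : ℝ))) ^ 2 = β ^ (-(2 : ℝ) / 39) := by
    rw [← Real.rpow_natCast, ← Real.rpow_mul hβ0.le]; norm_num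
  have hinv : 1 / β ≤ β ^ (-(2 : ℝ) / 39) := by
    rw [one_div, ← Real.rpow_neg_one]
    exact Real.rpow_le_rpow_of_exponent_le hβ (by norm_num)
  have hpos : 0 ≤ β ^ (-(2 : ℝ) / 39) := Real.rpow_nonneg hβ0.le _
  have e : 2 * (L' * (3 * β ^ (-(1 / 39 : ℝ)))) ^ 2 * 1 = 18 * L' ^ 2 * β ^ (-(2 : ℝ) / 39) := by
    rw [← hsq]; ring
  rw [e]
  nlinarith [sq_nonneg L']

/-- ★★★ **VACUUM TORELON CEILING at every fixed `L ≥ 2`**: there is `β₀(L)` such that for `β ≥ β₀`, every physical `l2`-normalised `Ω` with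
`K_βΩ = λ₀Ω` has `E_{Ω²}[F] ≤ (18L² + 4)·β^{−2/39}`, `F = flowLift 0 (4 − (Re tr P)²)` — the Polyakov holonomy of the exact zero-flux vacuum
concentrates at the centre.  Split §3 at `δ = 3β^{−1/39}` + FTR's ✓`GroundConc.groundState_outer_mass_le` (outer mass `≤ ‖Ω‖²/β`).
[cite: Luscher1983, §2–3] [cite: SimonB1983DiscreteSpectrum, §3] -/
theorem vacuum_torelon_mean_le (hL : 2 ≤ L) :
    ∃ β₀ : ℝ, ∀ β : ℝ, β₀ ≤ β → ∀ Ω : GaugeConfig 3 L SU2 → ℝ, IsPhys Ω → l2 Ω Ω = 1 →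
      transferApply β Ω = topValue su2Rep L β • Ω →
        l2 (fun U => flowLift 0 (fun u : GaugeConfig 3 1 SU2 => 4 - ((su2Rep (u ((0 : Site 3 1), (0 : Fin 3)))).trace.re) ^ 2) U * Ω U) Ω ≤
          (18 * (L : ℝ) ^ 2 + 4) * β ^ (-(2 : ℝ) / 39) := by
  obtain ⟨β0, h0⟩ := GroundConc.groundState_outer_mass_le hL
  refine ⟨max β0 1, fun β hβ Ω hΩ hn heig => ?_⟩
  have hβ0 : β0 ≤ β := (le_max_left _ _).trans hβ
  have hβ1 : 1 ≤ β := (le_max_right _ _).trans hβ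
  have hρ : powScale (1 / 39) β = β ^ (-(1 / 39 : ℝ)) := powScale_eq hβ1
  have hδ : 0 < 3 * powScale (1 / 39) β := by have := powScale_pos (1 / 39) β; positivity
  have hsplit := l2_torelon_mul_vacuum_le_inner_outer hδ hΩ
  have hout := h0 β hβ0 Ω hΩ heig
  rw [hn] at hsplit hout
  have hout' : l2 (fun U => Real.sin (innerPhase (3 * powScale (1 / 39) β) U) * Ω U)
      (fun U => Real.sin (innerPhase (3 * powScale (1 / 39) β) U) * Ω U) ≤ 1 / β := hout
  have harith := ceiling_arith hβ1 (L : ℝ)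
  rw [← hρ] at harith
  linarith

/-- ★★★ The same ceiling for the torelon deviation at ONE base point: `E_{Ω²}[d_x] ≤ (18L² + 4)·β^{−2/39}`, every site `x`.
[cite: Luscher1983, §2–3] [cite: SimonB1983DiscreteSpectrum, §3] -/
theorem vacuum_torelonAt_mean_le (hL : 2 ≤ L) :
    ∃ β₀ : ℝ, ∀ β : ℝ, β₀ ≤ β → ∀ Ω : GaugeConfig 3 L SU2 → ℝ, IsPhys Ω → l2 Ω Ω = 1 →
      transferApply β Ω = topValue su2Rep L β • Ω → ∀ x : Site 3 L,
        l2 (fun U => flowLiftAt x 0 (fun u : GaugeConfig 3 1 SU2 => 4 - ((su2Rep (u ((0 : Site 3 1), (0 : Fin 3)))).trace.re) ^ 2) U * Ω U) Ω ≤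
          (18 * (L : ℝ) ^ 2 + 4) * β ^ (-(2 : ℝ) / 39) := by
  obtain ⟨β0, h0⟩ := GroundConc.groundState_outer_mass_le hL
  refine ⟨max β0 1, fun β hβ Ω hΩ hn heig x => ?_⟩
  have hβ0 : β0 ≤ β := (le_max_left _ _).trans hβ
  have hβ1 : 1 ≤ β := (le_max_right _ _).trans hβ
  have hρ : powScale (1 / 39) β = β ^ (-(1 / 39 : ℝ)) := powScale_eq hβ1
  have hδ : 0 < 3 * powScale (1 / 39) β := by have := powScale_pos (1 / 39) β; positivity
  have hsplit := l2_torelonAt_mul_vacuum_le_inner_outer hδ x hΩ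
  have hout := h0 β hβ0 Ω hΩ heig
  rw [hn] at hsplit hout
  have hout' : l2 (fun U => Real.sin (innerPhase (3 * powScale (1 / 39) β) U) * Ω U)
      (fun U => Real.sin (innerPhase (3 * powScale (1 / 39) β) U) * Ω U) ≤ 1 / β := hout
  have harith := ceiling_arith hβ1 (L : ℝ)
  rw [← hρ] at harith
  linarith

/-! ## §5 The registered rung's letters with exponent `2/39`, at every `L₀ ≥ 2` -/

/-- ★★ **The fixed-torus rung of `MeanLoopCeilingWeak` at exponent `2/39`** (registered `FixedTorusRungP` of ⟨23353⟩ reads `−1/2`): for every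
`L₀ ≥ 2` there are `C, β₀` with `E_{Ω²}[F] ≤ C·β^{−2/39}` for `β ≥ β₀`, `L = L₀`, every physical `l2`-normalised exact vacuum.
[cite: Luscher1983, §2–3] [cite: SimonB1983DiscreteSpectrum, §3] -/
theorem fixedTorusRung_two_39 (L₀ : ℕ) (hL₀ : 2 ≤ L₀) :
    ∃ C β₀ : ℝ, ∀ β : ℝ, β₀ ≤ β → ∀ (L : ℕ) [NeZero L], L = L₀ →
      ∀ Ω : Literature.MathematicalPhysics.QuantumFieldTheory.GaugeConfig 3 L SU2 → ℝ, IsPhys Ω → l2 Ω Ω = 1 →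
        transferApply β Ω = topValue su2Rep L β • Ω →
        let F : Literature.MathematicalPhysics.QuantumFieldTheory.GaugeConfig 3 L SU2 → ℝ :=
          flowLift 0 (fun u : Literature.MathematicalPhysics.QuantumFieldTheory.GaugeConfig 3 1 SU2 =>
            4 - ((su2Rep (u ((0 : Literature.MathematicalPhysics.QuantumFieldTheory.Site 3 1), (0 : Fin 3)))).trace.re) ^ 2)
        l2 (fun U => F U * Ω U) Ω ≤ C * β ^ (-(2 : ℝ) / 39) := by
  haveI : NeZero L₀ := ⟨by omega⟩
  obtain ⟨β₀, h⟩ := vacuum_torelon_mean_le (L := L₀) hL₀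
  refine ⟨18 * (L₀ : ℝ) ^ 2 + 4, β₀, fun β hβ L _ hL Ω hΩ hn heig => ?_⟩
  subst hL
  exact h β hβ Ω hΩ hn heig

end Summit.QuantumFields.YangMills.Theorems.TransportFieldFano

end
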